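import Literature.Barriers.ValiantsHypothesis.AlgebraicNaturalProofsKRSTVNP
import Literature.Computability.AlgebraicComplexity.DefinableVNPWitness
import HarnessLib
import HarnessLib.Audit

/-!
# Succinct tables by Valiant's criterion: bit-circuit coefficient tables are `VNP`-succinct

Workshop decomp-valiant, lens 2 (succinctness axis), g35, CALLED offer O-L2-11; census road F1/W4 (rung
`ReadOnceDeterminantsHitByVNP`, recorded plan "Boolean-sum emulation of FGT16/GT17 weight points").
`F` of characteristic zero, `K = ⌊log₂ n⌋+1` bits per exponent (`kBits`). (E1) `engineSpec_holds` /
`tablePoly_mem_smallDefinable`: for a `B₂`-circuit `Q` on the `nK` exponent bits of `μ ∈ degLEMonomials n`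
and a post-processor `P ∈ F[g_1..g_{|Q|}]` WITH ARBITRARY CONSTANTS, the table `μ ↦ P(transcript_Q(bits μ))`
is the coefficient vector of `tablePoly Q P`, and `|Q|, L(P), deg P ≤ n^c`, `n ≥ 3` ⇒ `tablePoly Q P ∈
SmallDefinable F n (6(c+2))` (KRST Def. 3). Witness `[Σ μ_i(t) ≤ n]·Mon(t,x)·VALID_Q(t,g)·P(g)` = the KRST
§3.4 gadgets (`degIndicator`, `monSel`; there used for ONE table) × Valiant's criterion (`validPoly`,
`sum_eval_validPoly_mul`): an assembly of tree parts. (E2) `powPointSpec_holds`: `t`-power points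
`μ ↦ t^{w(μ)}`, `w < 2^J` read in binary off `J` gates, are `VNP`-succinct (post-processor
`∏_j (g_j t^{2^j} + 1 - g_j)`); Klivans–Spielman points and FGT16/GT17 isolating weights have this form, so
the tool FSV18 §8 "do not know how to emulate in the succinct setting" is emulable in the `VNP`-succinct
RELAXATION (the `VP`-succinct question, FSV Question 6 = crux 14610, is untouched). (E3) `isolationHit`: a
weight isolating a unique minimum-weight monomial of `supp D` gives `t` with `D(t^w) ≠ 0` (`F` infinite).
(E4) `doorSpec_holds`: small-circuit isolating weights for a family `𝒟` ⇒ `VNP`-succinct hitting sets for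
`𝒟`; for read-once determinants that hypothesis (Gurjar–Thierauf 2017 via mixed matrices) is NOT treated
here. Support theorems at LADDER-Valiant rung 0; nothing here bears on `VP ≠ VNP`. References:
[KumarRamyaSaptharishiTengse2022] §3.4, Def. 3; [Burgisser2000] Prop. 2.20; [ForbesShpilkaVolk2018] §8;
[KlivansSpielman2001] Thm. 3.
-/

noncomputable section

open MvPolynomial Finset

set_option linter.dupNamespace false

namespace Summit.ValiantsHypothesis.ValiantsHypothesis.Theorems.SuccinctTables

open Literature.Barriers.ValiantsHypothesis Literature.Computability.AlgebraicComplexity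
  Literature.Computability.Complexity CircuitArith BoolGadgets KRSTSucc

section Engine

variable (F : Type*) [Field F] {n : ℕ}

/-- Bits per exponent: `K = ⌊log₂ n⌋ + 1`. [cite: KumarRamyaSaptharishiTengse2022, §3.4] -/
def kBits (n : ℕ) : ℕ := Nat.log 2 n + 1

/-- `n < 2^K`. [folklore] -/
theorem lt_two_pow_kBits (n : ℕ) : n < 2 ^ kBits n := Nat.lt_pow_succ_log_self (by norm_num) n

/-- The exponent bits of a coordinate `μ`. [cite: KumarRamyaSaptharishiTengse2022, Observation 9] -/
def bitsOf (μ : degLEMonomials n) : Fin n × Fin (kBits n) → Bool := encodeBits fun i => (μ : Fin n →₀ ℕ) i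

variable (Q : Circuit (Fin n × Fin (kBits n))) (P : MvPolynomial (Fin Q.size) F)

/-- The coefficient TABLE `μ ↦ P(transcript of Q on bits(μ))`. [cite: Burgisser2000, Prop. 2.20] -/
def table (μ : degLEMonomials n) : F := eval (fun j => toK F (trueTranscript Q (bitsOf μ) j)) P

/-- The degree-`≤ n` polynomial with that coefficient table. [cite: KumarRamyaSaptharishiTengse2022, §3.5] -/
def tablePoly : MvPolynomial (Fin n) F := ∑ μ : degLEMonomials n, C (table F Q P μ) * monomial (μ : Fin n →₀ ℕ) 1

/-- `VALID_Q(t, g) · P(g)` in the variables `x ⊕ (t ⊕ g)` (construction datum). [cite: Burgisser2000, Prop. 2.20] -/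
def validPost : MvPolynomial (Var n (kBits n) Q.size) F :=
  rename Sum.inr (validPoly (k := F) Q) * rename (Sum.inr ∘ Sum.inr) P

/-- **The witness** `[Σ μ_i(t) ≤ n]·Mon(t,x)·VALID_Q(t,g)·P(g)` (construction datum). [cite: KumarRamyaSaptharishiTengse2022, §3.4] -/
def witnessT [CharZero F] : MvPolynomial (Var n (kBits n) Q.size) F :=
  liftT F (degIndicator F n (kBits n)) * monSel F * validPost F Q P

variable {F}

/-- Coefficients of the table polynomial. [cite: KumarRamyaSaptharishiTengse2022, §3.5] -/
theorem coeff_tablePoly (μ : degLEMonomials n) : coeff (μ : Fin n →₀ ℕ) (tablePoly F Q P) = table F Q P μ := by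
  classical
  unfold tablePoly
  rw [coeff_sum, Finset.sum_eq_single μ]
  · rw [coeff_C_mul, coeff_monomial, if_pos rfl, mul_one]
  · intro ν _ hνμ; rw [coeff_C_mul, coeff_monomial, if_neg (fun h => hνμ (Subtype.ext h)), mul_zero]
  · intro h; exact absurd (Finset.mem_univ μ) h

/-- The table polynomial has degree `≤ n`. [cite: KumarRamyaSaptharishiTengse2022, §3.5] -/
theorem totalDegree_tablePoly_le : (tablePoly F Q P).totalDegree ≤ n := by
  refine (totalDegree_finsetSum _ _).trans (Finset.sup_le fun μ _ => (totalDegree_mul _ _).trans ?_)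
  rw [totalDegree_C, zero_add]
  have h := μ.2; simp only [degLEMonomials, Set.mem_setOf_eq, Finsupp.degree_apply] at h
  exact (totalDegree_monomial_le _ _).trans h

/-- `VALID_Q · P` at a Boolean point. [cite: Burgisser2000, Prop. 2.20] -/
theorem aeval_bsub_validPost (e : Blk n (kBits n) Q.size → Bool) :
    aeval (bsub F e) (validPost F Q P) = C (eval (bpt F (e ∘ Sum.inl) (e ∘ Sum.inr))
      (validPoly (k := F) Q) * eval (fun j => toK F (e (Sum.inr j))) P) := by
  unfold validPost
  have hf : (bsub F e ∘ Sum.inr) = fun v : Blk n (kBits n) Q.size => C (bpt F (e ∘ Sum.inl) (e ∘ Sum.inr) v) := by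
    funext v
    rcases v with ik | j <;> simp [bsub, bpt, toK, apply_ite C]
  have hg : (bsub F e ∘ (Sum.inr ∘ Sum.inr)) = fun j : Fin Q.size => C (toK F (e (Sum.inr j))) := by
    funext j; simp [bsub, toK, apply_ite C]
  rw [map_mul, aeval_rename, hf, aeval_C_comp, aeval_rename, hg, aeval_C_comp, ← map_mul]

/-- `L(VALID_Q · P) ≤ 60|Q| + L(P) + 1` and `deg ≤ 3|Q| + deg P`. [cite: Burgisser2000, Prop. 2.20] -/
theorem validPost_bounds : complexity (validPost F Q P) ≤ 60 * Q.size + complexity P + 1 ∧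
    (validPost F Q P).totalDegree ≤ 3 * Q.size + P.totalDegree := by
  have hQ : (Finset.univ : Finset (Fin Q.size)).card = Q.size := by simp
  have hc : complexity (validPoly (k := F) Q) ≤ 60 * Q.size := by
    unfold validPoly
    refine (complexity_finset_prod_le _ _).trans ?_
    have := Finset.sum_le_sum fun j (_ : j ∈ Finset.univ) => complexity_consPoly_le (k := F) Q j
    rw [Finset.sum_const, smul_eq_mul, hQ] at this
    omega
  have hd : (validPoly (k := F) Q).totalDegree ≤ 3 * Q.size := by
    unfold validPoly
    refine (totalDegree_finsetProd _ _).trans ?_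
    have := Finset.sum_le_sum fun j (_ : j ∈ Finset.univ) => totalDegree_consPoly_le (k := F) Q j
    rw [Finset.sum_const, smul_eq_mul, hQ] at this
    omega
  unfold validPost
  exact ⟨(complexity_mul_le_holds _ _).trans (add_le_add (add_le_add
      ((complexity_rename_le_holds' _ _).trans hc) (complexity_rename_le_holds' _ _)) le_rfl),
    (totalDegree_mul _ _).trans (add_le_add ((totalDegree_rename_le _ _).trans hd) (totalDegree_rename_le _ _))⟩

variable [CharZero F]

/-- The witness at the Boolean point `(t, g) = (et, es)`. [cite: KumarRamyaSaptharishiTengse2022, §3.4] -/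
theorem aeval_bsub_witnessT (et : Fin n × Fin (kBits n) → Bool) (es : Fin Q.size → Bool) :
    aeval (bsub F ((Equiv.sumArrowEquivProdArrow _ _ Bool).symm (et, es))) (witnessT F Q P) =
      C ((if ∑ i : Fin n, decodeBits et i ≤ n then (1 : F) else 0) *
          (eval (bpt F et es) (validPoly (k := F) Q) * eval (fun j => toK F (es j)) P)) *
        monomial (Finsupp.equivFunOnFinite.symm (decodeBits et)) 1 := by
  set e := (Equiv.sumArrowEquivProdArrow _ _ Bool).symm (et, es) with he
  have h1 : e ∘ Sum.inl = et := by funext ik; simp [he]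
  have h2 : e ∘ Sum.inr = es := by funext j; simp [he]
  have h3 : (fun j => toK F (e (Sum.inr j))) = fun j => toK F (es j) := by funext j; simp [he]
  unfold witnessT
  rw [map_mul, map_mul, aeval_bsub_liftT, eval_degIndicator, aeval_bsub_monSel, aeval_bsub_validPost, h1, h2, h3]
  simp only [map_mul]
  ring

/-- **The Boolean-sum identity** `Σ_{(t,g)} witness = tablePoly Q P`: the gate-bit sum collapses to the true
transcript (Valiant's criterion), the exponent-bit sum is reindexed by `μ`. [cite: KumarRamyaSaptharishiTengse2022, §3.4] -/
theorem sum_aeval_witnessT (hQ : Q.IsOver B2) :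
    ∑ e : Blk n (kBits n) Q.size → Bool, aeval (bsub F e) (witnessT F Q P) = tablePoly F Q P := by
  classical
  rw [← (Equiv.sumArrowEquivProdArrow _ _ Bool).symm.sum_comp, Fintype.sum_prod_type]
  have hinner : ∀ et : Fin n × Fin (kBits n) → Bool, ∑ es : Fin Q.size → Bool,
      aeval (bsub F ((Equiv.sumArrowEquivProdArrow _ _ Bool).symm (et, es))) (witnessT F Q P) =
        C ((if ∑ i : Fin n, decodeBits et i ≤ n then (1 : F) else 0) *
          eval (fun j => toK F (trueTranscript Q et j)) P) *
            monomial (Finsupp.equivFunOnFinite.symm (decodeBits et)) 1 := by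
    intro et
    simp only [aeval_bsub_witnessT]
    rw [← Finset.sum_mul, ← map_sum, ← Finset.mul_sum,
      sum_eval_validPoly_mul Q hQ et fun y => eval (fun j => toK F (y j)) P]
  simp only [hinner]
  unfold tablePoly
  rw [← Finset.sum_filter_add_sum_filter_not (Finset.univ : Finset (Fin n × Fin (kBits n) → Bool))
    (fun et => ∑ i, decodeBits et i ≤ n), Finset.sum_eq_zero (s := Finset.univ.filter
      fun et : Fin n × Fin (kBits n) → Bool => ¬ ∑ i, decodeBits et i ≤ n)
    (fun et het => by rw [if_neg (Finset.mem_filter.1 het).2, zero_mul, C_0, zero_mul]), add_zero]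
  have hμK : ∀ μ : degLEMonomials n, ∀ i, (μ : Fin n →₀ ℕ) i < 2 ^ kBits n := fun μ i =>
    lt_of_le_of_lt ((Finsupp.le_degree i _).trans μ.2) (lt_two_pow_kBits n)
  have hvalid : ∀ μ : degLEMonomials n, ∑ i, decodeBits (bitsOf μ) i ≤ n := fun μ => by
    have := μ.2; simp only [degLEMonomials, Set.mem_setOf_eq, Finsupp.degree_eq_sum] at this
    rwa [bitsOf, decodeBits_encodeBits (hμK μ)]
  refine Finset.sum_nbij' (fun et => if h : ∑ i, decodeBits et i ≤ n then toMono et h else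
      ⟨0, by simp [degLEMonomials]⟩) bitsOf (fun _ _ => Finset.mem_univ _)
    (fun μ _ => Finset.mem_filter.2 ⟨Finset.mem_univ _, hvalid μ⟩) ?_ ?_ ?_
  · intro et het; simp [bitsOf, encodeBits_decodeBits, toMono, dif_pos (Finset.mem_filter.1 het).2]
  · intro μ _; rw [dif_pos (hvalid μ)]
    exact Subtype.ext (Finsupp.ext fun i => by simp [toMono, bitsOf, decodeBits_encodeBits (hμK μ)])
  · intro et het
    have hv : ∑ i, decodeBits et i ≤ n := (Finset.mem_filter.1 het).2
    have hee : bitsOf (toMono et hv) = et := by simpa [bitsOf, toMono] using encodeBits_decodeBits et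
    rw [if_pos hv, one_mul, dif_pos hv, table, hee]
    rfl

/-- Size, degree and arity of the witness are `≤ n^{6(c+2)}` when `|Q|, L(P), deg P ≤ n^c`, `n ≥ 3`
(all parameters `≤ T = n^{c+2}`; `L ≤ 80 T⁴`, `deg ≤ 7 T⁴`). [cite: KumarRamyaSaptharishiTengse2022, §3.4] -/
theorem witnessT_le_pow {c : ℕ} (hn : 3 ≤ n) (hs : Q.size ≤ n ^ c) (hcP : complexity P ≤ n ^ c)
    (hdP : P.totalDegree ≤ n ^ c) :
    complexity (witnessT F Q P) ≤ n ^ (6 * (c + 2)) ∧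
      (witnessT F Q P).totalDegree ≤ n ^ (6 * (c + 2)) ∧ n * kBits n + Q.size ≤ n ^ (6 * (c + 2)) := by
  obtain ⟨hc, hd⟩ := validPost_bounds Q P
  have hwc : complexity (witnessT F Q P) ≤
      ((n * 2 ^ kBits n + 1) * (2 * (n * 2 ^ kBits n) + 2) + 2 * (n * kBits n)) +
        (n * kBits n * 2 ^ kBits n + 5 * (n * kBits n)) + 1 + (60 * Q.size + complexity P + 1) + 1 := by
    unfold witnessT liftT
    exact (complexity_mul_le_holds _ _).trans (add_le_add (add_le_add ((complexity_mul_le_holds _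
      _).trans (add_le_add (add_le_add ((complexity_rename_le_holds' _ _).trans
      (complexity_degIndicator_le F)) (complexity_monSel_le (F := F))) le_rfl)) hc) le_rfl)
  have hwd : (witnessT F Q P).totalDegree ≤
      n * 2 ^ kBits n + n * kBits n * (1 + 2 ^ kBits n) + (3 * Q.size + P.totalDegree) := by
    unfold witnessT liftT
    exact (totalDegree_mul _ _).trans (add_le_add ((totalDegree_mul _ _).trans (add_le_add
      ((totalDegree_rename_le _ _).trans (totalDegree_degIndicator_le F))
      (totalDegree_monSel_le (F := F)))) hd)
  set T := n ^ (c + 2) with hT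
  have hn0 : n ≠ 0 := (by omega); have h1 : 1 ≤ n := (by omega)
  have hnT : n ≤ T := Nat.le_self_pow (by omega) n
  have hKT : kBits n ≤ T := (Nat.succ_le_of_lt (Nat.log_lt_self 2 hn0)).trans hnT
  have hn2 : n ^ 2 ≤ T := Nat.pow_le_pow_right h1 (by omega)
  have h2KT : 2 ^ kBits n ≤ T := by
    calc 2 ^ kBits n = 2 ^ Nat.log 2 n * 2 := pow_succ _ _
      _ ≤ n * n := Nat.mul_le_mul (Nat.pow_log_le_self 2 hn0) (by omega)
      _ ≤ T := by rw [← sq]; exact hn2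
  have hcT : n ^ c ≤ T := Nat.pow_le_pow_right h1 (by omega); have hsT := hs.trans hcT; have hPT := hcP.trans hcT
  have hdT := hdP.trans hcT
  have h9 : 9 ≤ n ^ 2 := by nlinarith
  have h81 : 81 ≤ T ^ 2 := by rw [sq]; exact le_trans (Nat.mul_le_mul h9 h9) (Nat.mul_le_mul hn2 hn2)
  have hT1 : 1 ≤ T := by omega
  have hpow : T ^ 2 * T ^ 4 = n ^ (6 * (c + 2)) := by rw [← pow_add, hT, ← pow_mul, mul_comm]
  have e1 : T ≤ T ^ 4 := Nat.le_self_pow (by norm_num) T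
  have e2 : T ^ 2 ≤ T ^ 4 := Nat.pow_le_pow_right hT1 (by norm_num); have e3 : T ^ 3 ≤ T ^ 4 := Nat.pow_le_pow_right hT1 (by norm_num)
  refine ⟨hwc.trans ?_, hwd.trans ?_, ?_⟩
  · calc _ ≤ ((T * T + 1) * (2 * (T * T) + 2) + 2 * (T * T)) + (T * T * T + 5 * (T * T)) + 1 +
          (60 * T + T + 1) + 1 := by gcongr
      _ = 2 * T ^ 4 + T ^ 3 + 11 * T ^ 2 + 61 * T + 5 := by ring
      _ ≤ T ^ 2 * T ^ 4 := le_trans (by omega : _ ≤ 80 * T ^ 4) (Nat.mul_le_mul_right _ (by omega))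
      _ = n ^ (6 * (c + 2)) := hpow
  · calc _ ≤ T * T + T * T * (1 + T) + (3 * T + T) := by gcongr
      _ = T ^ 3 + 2 * T ^ 2 + 4 * T := by ring
      _ ≤ T ^ 2 * T ^ 4 := le_trans (by omega : _ ≤ 7 * T ^ 4) (Nat.mul_le_mul_right _ (by omega))
      _ = n ^ (6 * (c + 2)) := hpow
  · calc n * kBits n + Q.size ≤ T * T + T := by gcongr
      _ = T ^ 2 + T := by ring
      _ ≤ T ^ 2 * T ^ 4 := le_trans (by omega : _ ≤ 2 * T ^ 4) (Nat.mul_le_mul_right _ (by omega))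
      _ = n ^ (6 * (c + 2)) := hpow

/-- **(E1) THE ENGINE**: `|Q|, L(P), deg P ≤ n^c`, `n ≥ 3` ⇒ `tablePoly Q P ∈ SmallDefinable F n (6(c+2))`. [cite: Burgisser2000, Prop. 2.20] -/
theorem tablePoly_mem_smallDefinable {c : ℕ} (hn : 3 ≤ n) (hQ : Q.IsOver B2) (hs : Q.size ≤ n ^ c)
    (hcP : complexity P ≤ n ^ c) (hdP : P.totalDegree ≤ n ^ c) :
    tablePoly F Q P ∈ SmallDefinable F n (6 * (c + 2)) := by
  classical
  obtain ⟨hb1, hb2, hb3⟩ := witnessT_le_pow Q P hn hs hcP hdP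
  set ε : Blk n (kBits n) Q.size ≃ Fin (Fintype.card (Blk n (kBits n) Q.size)) := Fintype.equivFin _
  refine ⟨totalDegree_tablePoly_le Q P, Fintype.card (Blk n (kBits n) Q.size), by rwa [card_blk],
    rename (Sum.map id ε) (witnessT F Q P), (complexity_rename_le_holds' _ _).trans hb1,
    (totalDegree_rename_le _ _).trans hb2, ?_⟩
  rw [← sum_aeval_witnessT Q P hQ]
  unfold boolSum
  refine (Fintype.sum_equiv (Equiv.arrowCongr ε (Equiv.refl Bool)).symm _ _ fun e => ?_).symm
  have hf : ((Sum.elim X fun j => if e j then (1 : MvPolynomial (Fin n) F) else 0) ∘ Sum.map id ε) =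
      bsub F ((Equiv.arrowCongr ε (Equiv.refl Bool)).symm e) := by
    funext v
    rcases v with i | b
    · simp [bsub]
    · simp [bsub, Equiv.arrowCongr]
  rw [aeval_rename, hf]

end Engine

section Pow

variable {F : Type*} [Field F] {n J : ℕ} (Q : Circuit (Fin n × Fin (kBits n))) (out : Fin J → Fin Q.size) (t : F)

/-- The weight `w(μ) < 2^J` read in binary off `J` designated gates. [cite: KlivansSpielman2001, Thm. 3] -/
def weightOf (μ : degLEMonomials n) : ℕ := Nat.ofBits fun j => trueTranscript Q (bitsOf μ) (out j)

/-- The post-processor `∏_j (g_{out j} t^{2^j} + 1 - g_{out j})` (construction datum). [cite: KumarRamyaSaptharishiTengse2022, Observation 9] -/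
def powPost : MvPolynomial (Fin Q.size) F := selProd (fun j => X (out j)) fun j => C (t ^ 2 ^ (j : ℕ))

/-- Its value at gate bits: `t^{Σ_j [g_{out j}] 2^j}`. [cite: KumarRamyaSaptharishiTengse2022, Observation 9] -/
theorem eval_powPost (y : Fin Q.size → Bool) :
    eval (fun j => toK F (y j)) (powPost Q out t) = t ^ Nat.ofBits fun j => y (out j) := by
  unfold powPost selProd
  rw [map_prod, ofBits_eq_sum, ← Finset.prod_pow_eq_pow_sum]
  refine Finset.prod_congr rfl fun j _ => ?_
  cases h : y (out j) <;> simp [h, toK]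

/-- `L(powPost) ≤ 5J`, `deg ≤ J`. [cite: KumarRamyaSaptharishiTengse2022, Observation 9] -/
theorem powPost_bounds : complexity (powPost Q out t) ≤ 5 * J ∧ (powPost Q out t).totalDegree ≤ J := by
  refine ⟨(complexity_selProd_le _ _).trans ?_, (totalDegree_selProd_le _ _).trans ?_⟩
  · rw [Finset.sum_eq_zero fun j _ => by rw [complexity_X_holds, complexity_C_holds]; simp, zero_add]
  · calc _ ≤ ∑ _j : Fin J, 1 := Finset.sum_le_sum fun j _ => by
          rw [totalDegree_C, add_zero]; exact (isHomogeneous_X F _).totalDegree_le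
      _ = J := by simp

variable (F)

/-- **(E1) named**: every bit-circuit table with a constants-carrying algebraic post-processor is `VNP`-succinct,
one exponent `b` per resource exponent `c`. [cite: Burgisser2000, Prop. 2.20] -/
def EngineSpec [CharZero F] : Prop := ∀ c : ℕ, ∃ b n₀ : ℕ, ∀ n : ℕ, n₀ ≤ n →
    ∀ Q : Circuit (Fin n × Fin (kBits n)), Q.IsOver B2 → Q.size ≤ n ^ c →
    ∀ P : MvPolynomial (Fin Q.size) F, complexity P ≤ n ^ c → P.totalDegree ≤ n ^ c →
      tablePoly F Q P ∈ SmallDefinable F n b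

/-- **(E1) PROVED** with `b = 6(c+2)`, `n₀ = 3`. [cite: Burgisser2000, Prop. 2.20] -/
theorem engineSpec_holds [CharZero F] : EngineSpec F := fun c =>
  ⟨6 * (c + 2), 3, fun _ hn Q hQ hs P hcP hdP => tablePoly_mem_smallDefinable Q P hn hQ hs hcP hdP⟩

/-- **(E2) as a named statement.** [cite: KlivansSpielman2001, Thm. 3] -/
def PowPointSpec [CharZero F] : Prop := ∀ c : ℕ, ∃ b n₀ : ℕ, ∀ n : ℕ, n₀ ≤ n →
    ∀ (J : ℕ) (Q : Circuit (Fin n × Fin (kBits n))) (out : Fin J → Fin Q.size) (t : F),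
      Q.IsOver B2 → Q.size ≤ n ^ c → J ≤ n ^ c →
      ∃ g ∈ SmallDefinable F n b, ∀ μ : degLEMonomials n, coeff (μ : Fin n →₀ ℕ) g = t ^ weightOf Q out μ

/-- **(E2) PROVED** (`b = 6(c+4)`, `n₀ = 3`): `t`-power points with small-circuit binary weights (Klivans–Spielman
points, FGT16/GT17 isolating weights) are `VNP`-succinct. [cite: KlivansSpielman2001, Thm. 3] -/
theorem powPointSpec_holds [CharZero F] : PowPointSpec F := by
  refine fun c => ⟨6 * (c + 2 + 2), 3, fun n hn J Q out t hQ hs hJ => ?_⟩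
  have hc2 : n ^ c ≤ n ^ (c + 2) := Nat.pow_le_pow_right (by omega) (by omega)
  have h5 : 5 * J ≤ n ^ (c + 2) := by
    calc 5 * J ≤ n ^ 2 * n ^ c := Nat.mul_le_mul (le_trans (by norm_num) (by nlinarith : 9 ≤ n ^ 2)) hJ
      _ = n ^ (c + 2) := by rw [← pow_add, add_comm]
  obtain ⟨hcx, hdeg⟩ := powPost_bounds Q out t
  exact ⟨tablePoly F Q (powPost Q out t), tablePoly_mem_smallDefinable Q _ hn hQ (hs.trans hc2)
    (hcx.trans h5) (hdeg.trans (hJ.trans hc2)), fun μ => by rw [coeff_tablePoly]; exact eval_powPost Q out t _⟩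

end Pow

section Isolation

variable (F : Type*) [Field F]

/-- `w` isolates a unique minimum-weight monomial of `supp D` (weight of `m` = `Σ_μ m(μ) w(μ)`). [cite: KlivansSpielman2001, Thm. 3] -/
def IsolatesMin {N : Type*} (w : N → ℕ) (D : MvPolynomial N F) : Prop :=
  ∃ m₀ ∈ D.support, ∀ m ∈ D.support, m ≠ m₀ → (m₀.sum fun μ k => k * w μ) < (m.sum fun μ k => k * w μ)

/-- **(E3) as a named statement.** [cite: KlivansSpielman2001, Thm. 3] -/
def IsolationHitSpec : Prop := Infinite F → ∀ (N : Type) [Fintype N] (w : N → ℕ) (D : MvPolynomial N F),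
    IsolatesMin F w D → ∃ t : F, eval (fun μ => t ^ w μ) D ≠ 0

variable {F}

/-- The `t`-substitution `c_μ ↦ t^{w(μ)}` through the univariate image `Σ_m a_m X^{wt m}`. [folklore] -/
theorem eval_pow_eq_eval_univ {N : Type*} (w : N → ℕ) (D : MvPolynomial N F) (t : F) :
    eval (fun μ => t ^ w μ) D = Polynomial.eval t
      (∑ m ∈ D.support, Polynomial.C (coeff m D) * Polynomial.X ^ (m.sum fun μ k => k * w μ)) := by
  have hex : aeval (fun μ => (Polynomial.X : Polynomial F) ^ w μ) D =
      ∑ m ∈ D.support, Polynomial.C (coeff m D) * Polynomial.X ^ (m.sum fun μ k => k * w μ) := by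
    conv_lhs => rw [D.as_sum]
    rw [map_sum]
    refine Finset.sum_congr rfl fun m _ => ?_
    rw [aeval_monomial, ← Polynomial.C_eq_algebraMap, Finsupp.prod, Finsupp.sum, ← Finset.prod_pow_eq_pow_sum]
    exact congrArg _ (Finset.prod_congr rfl fun μ _ => by rw [← pow_mul, mul_comm])
  rw [← hex, ← Polynomial.coe_aeval_eq_eval, ← AlgHom.comp_apply, comp_aeval]
  simp only [map_pow, Polynomial.aeval_X]
  rw [MvPolynomial.aeval_eq_eval]

/-- **(E3) PROVED**: a unique minimum-weight monomial survives the `t`-substitution, so over an infinite field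
some `t` is not a root. [cite: KlivansSpielman2001, Thm. 3] -/
theorem isolationHit [Infinite F] {N : Type*} (w : N → ℕ) (D : MvPolynomial N F)
    (h : IsolatesMin F w D) : ∃ t : F, eval (fun μ => t ^ w μ) D ≠ 0 := by
  classical
  obtain ⟨m₀, hm₀, hmin⟩ := h
  set p := ∑ m ∈ D.support, Polynomial.C (coeff m D) * Polynomial.X ^ (m.sum fun μ k => k * w μ) with hp
  have hcoeff : p.coeff (m₀.sum fun μ k => k * w μ) = coeff m₀ D := by
    rw [hp, Polynomial.finsetSum_coeff, Finset.sum_eq_single m₀]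
    · rw [Polynomial.coeff_C_mul_X_pow, if_pos rfl]
    · intro m hm hne; rw [Polynomial.coeff_C_mul_X_pow, if_neg (hmin m hm hne).ne]
    · intro h; exact absurd hm₀ h
  have hp0 : p ≠ 0 := fun h0 => (mem_support_iff.1 hm₀) (by rw [← hcoeff, h0, Polynomial.coeff_zero])
  by_contra hall
  refine hp0 (Polynomial.funext fun t => ?_)
  rw [Polynomial.eval_zero, hp, ← eval_pow_eq_eval_univ]
  by_contra ht
  exact hall ⟨t, ht⟩

/-- (E3) in the named form. [cite: KlivansSpielman2001, Thm. 3] -/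
theorem isolationHitSpec_holds : IsolationHitSpec F := fun hF _ _ w D h =>
  haveI := hF; isolationHit w D h

variable (F)

/-- Small-circuit ISOLATING WEIGHTS for a family of distinguishers `𝒟 n ⊆ F[c_μ : |μ| ≤ n]`: for
every nonzero `D ∈ 𝒟 n`, a `B₂`-circuit of size `≤ n^c` on the exponent bits with `J ≤ n^c` output
gates whose binary weight isolates a unique minimum-weight monomial of `supp D`. HYPOTHESIS-only `Prop`.
[status: for read-once determinants (census W4) = Gurjar–Thierauf 2017 linear-matroid-intersection isolation
through the mixed-matrix dictionary; NOT formalised; stage 2 uncalled] [cite: ForbesShpilkaVolk2018, §8] -/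
def SmallIsolatingWeights (𝒟 : (n : ℕ) → Set (MvPolynomial (degLEMonomials n) F)) (c : ℕ) : Prop :=
  ∃ n₁ : ℕ, ∀ n : ℕ, n₁ ≤ n → ∀ D ∈ 𝒟 n, D ≠ 0 →
    ∃ (J : ℕ) (Q : Circuit (Fin n × Fin (kBits n))) (out : Fin J → Fin Q.size),
      Q.IsOver B2 ∧ Q.size ≤ n ^ c ∧ J ≤ n ^ c ∧ IsolatesMin F (weightOf Q out) D

/-- **(E4) named**: small-circuit isolating weights ⇒ `VNP`-succinct hitting sets. [cite: ForbesShpilkaVolk2018, §8] -/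
def DoorSpec [CharZero F] [Infinite F] (𝒟 : (n : ℕ) → Set (MvPolynomial (degLEMonomials n) F)) : Prop :=
  ∀ c : ℕ, SmallIsolatingWeights F 𝒟 c → ∃ b n₀ : ℕ, ∀ n : ℕ, n₀ ≤ n →
    IsSuccinctHittingSet (degLEMonomials n) (SmallDefinable F n b) (𝒟 n)

/-- **(E4) PROVED** (E2 + E3). With `𝒟 n =` read-once determinants `∩ Distinguishers ℂ n 1` the
conclusion is the census rung `ReadOnceDeterminantsHitByVNP`. [cite: ForbesShpilkaVolk2018, §8] -/
theorem doorSpec_holds [CharZero F] [Infinite F]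
    (𝒟 : (n : ℕ) → Set (MvPolynomial (degLEMonomials n) F)) : DoorSpec F 𝒟 := by
  rintro c ⟨n₁, hiso⟩
  obtain ⟨b, n₀, hpow⟩ := powPointSpec_holds (F := F) c
  refine ⟨b, max n₀ n₁, fun n hn D hD hD0 => ?_⟩
  obtain ⟨J, Q, out, hQ, hs, hJ, hmin⟩ := hiso n ((le_max_right _ _).trans hn) D hD hD0
  obtain ⟨t, ht⟩ := isolationHit (weightOf Q out) D hmin
  obtain ⟨g, hg, hcoeff⟩ := hpow n ((le_max_left _ _).trans hn) J Q out t hQ hs hJ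
  have hv : coeffVector (degLEMonomials n) g = fun μ => t ^ weightOf Q out μ := funext hcoeff
  exact ⟨g, hg, by rw [hv]; exact ht⟩

end Isolation

end Summit.ValiantsHypothesis.ValiantsHypothesis.Theorems.SuccinctTables
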